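import Summits.KontsevichZagierPeriods.KontsevichZagierPeriods.Theses.FurushoPentagon
import Summits.KontsevichZagierPeriods.KontsevichZagierPeriods.Theorems.HurwitzMicroSectorsNormalFormPrincipleSplitGlue
import Literature.NumberTheory.Transcendental.KZProductIdeal
import Literature.NumberTheory.Transcendental.KZRulesAssociator

/-!
# `ReducedPeriodRing` (stmt-KontsevichZagierPeriods-3929) split along `[π]`:
# reducedness of the rules ring = (reducedness away from `[π]`) ∧ (`[π]`-cancellation)

Crux `FurushoPentagon.ReducedPeriodRing` (the formal period ring `P = KZ.FormalRep ⧸ KZ.relations`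
of the Kontsevich–Zagier calculus has no nilpotents). Strategist's DECOMPOSITION (crux-strategist
unit `cstrat-stmt-KontsevichZagierPeriods-3929-p1`), glued:

* `ReducedPeriodRing_of_subs : NilIsPiTorsion → PiCancellation → ReducedPeriodRing`, where both
  hypotheses are WRITTEN OUT in the pinned-product idiom of route AyoubSpecialisation
  (`P n r = [π] ⋆ r : IntegralRep (n + 2)`, disc in the two leading coordinates):
  - `NilIsPiTorsion` — every square-zero class becomes a relation after enough multiplications by
    `[π]`: verbatim item stmt-KontsevichZagierPeriods-0541 (`AyoubPiLocalKernel`) with its hypothesis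
    `KZ.eval c = 0` STRENGTHENED to `c * c ∈ KZ.relations`; ring-theoretically `IsReduced P[1/[π]]`
    (reducedness of Kontsevich–Zagier's extended algebra `P̂ = P[(2πi)⁻¹]`, *Periods* §4.1, in the
    rules presentation). Transcendence-free; its motivic analogue (nilpotents of the effective Nori
    period algebra are `2πi`-power torsion) is a THEOREM (torsor + Cartier), and its rules version is
    theorem-type modulo cube resolution (item 3574), a sound Nori/Ayoub symbol and Ayoub 2014 Prop. 11
    (crux workfile `Cruxes/ReducedPeriodRing/Lines/ayoub-stokes-cartier.md`).
  - `PiCancellation` — verbatim item stmt-KontsevichZagierPeriods-0540 (`[π] ⋆ c ∈ relations →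
    c ∈ relations`), the period-conjecture-type leaf, shared with routes AyoubSpecialisation /
    KatzTower / HurwitzMicroSectors.
  Proof: the pinned product exists (`exists_pinnedProduct`, landed in
  `Theorems/HurwitzMicroSectorsNormalFormPrincipleSplitGlue.lean`), so neither hypothesis is consumed
  vacuously; peel the `N` factors `[π]` one at a time (induction on `N`, left-nested iterates).
* Lattice lemmas (why the cut is honest): `nilIsPiTorsion_of_reducedPeriodRing` (crux ⇒ child 1,
  `N = 0`), `nilIsPiTorsion_of_piLocalKernel` (item 0541 ⇒ child 1, since `c * c ∈ relations ⇒
  eval c = 0`), so child 1 is a COMMON WEAKENING of the crux and of 0541; and the closed-term form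
  `reducedPeriodRing_of_closed` over `KZ.of KZ.piRep * ·` (the shape of `KZ.PiLocalKernel` /
  `KZ.PiCancellation`), for lines that work with the literal disc.
  Independence of the two children over the abstract interface (drop-one models) is
  `Theorems/ReducedPeriodRing/Negative/LineLoadBearing.lean` / crux workfile `SketchLineChecks.lean`.

References: M. Kontsevich, D. Zagier, *Periods* (2001), §1.2, §4.1 (`P̂ = P[(2πi)⁻¹]`); J. Ayoub,
*Periods and the conjectures of Grothendieck and Kontsevich–Zagier*, EMS Newsl. 91 (2014), Def. 6,
Conj. 7, Prop. 11; A. Huber, S. Müller-Stach, *Periods and Nori Motives* (2017), §13.1–13.2;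
A. Huber, G. Wüstholz, *Transcendence and linear relations of 1-periods* (2022), App. A.4.
-/

noncomputable section

namespace Summit.KontsevichZagierPeriods.FurushoPentagon.ReducedPeriodRingSplit

open Literature.NumberTheory.Transcendental Literature.NumberTheory.Transcendental.KZ
open Summit.KontsevichZagierPeriods.KontsevichZagierPeriods.Theses.FurushoPentagon

/-- **The split, glued** (deciding shape `Sub₁ → Sub₂ → Crux`, both children written out):
if every square-zero class is `[π] ⋆`-power torsion modulo relations (child `NilIsPiTorsion`, pinned
form) and `[π] ⋆ ·` reflects relations (child `PiCancellation` = item stmt-KontsevichZagierPeriods-0540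
verbatim), then the formal period ring has no nilpotents. [cite: KontsevichZagier2001, §4.1] -/
theorem ReducedPeriodRing_of_subs :
    (∀ (P : ∀ n : ℕ, Literature.NumberTheory.Transcendental.KZ.IntegralRep n → Literature.NumberTheory.Transcendental.KZ.IntegralRep (n + 2)), (∀ (n : ℕ) (r : Literature.NumberTheory.Transcendental.KZ.IntegralRep n), (P n r).domain = {z : Fin (n + 2) → ℝ | z 0 ^ 2 + z 1 ^ 2 ≤ 1 ∧ (fun i : Fin n => z i.succ.succ) ∈ r.domain} ∧ (P n r).integrand = fun z => r.integrand (fun i : Fin n => z i.succ.succ)) → ∀ c : Literature.NumberTheory.Transcendental.KZ.FormalRep, c * c ∈ Literature.NumberTheory.Transcendental.KZ.relations → ∃ N : ℕ, (⇑(FreeAbelianGroup.lift (fun s : (Σ n, Literature.NumberTheory.Transcendental.KZ.IntegralRep n) => Literature.NumberTheory.Transcendental.KZ.of (P s.1 s.2))))^[N] c ∈ Literature.NumberTheory.Transcendental.KZ.relations) →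
    (∀ (P : ∀ n : ℕ, Literature.NumberTheory.Transcendental.KZ.IntegralRep n → Literature.NumberTheory.Transcendental.KZ.IntegralRep (n + 2)), (∀ (n : ℕ) (r : Literature.NumberTheory.Transcendental.KZ.IntegralRep n), (P n r).domain = {z : Fin (n + 2) → ℝ | z 0 ^ 2 + z 1 ^ 2 ≤ 1 ∧ (fun i : Fin n => z i.succ.succ) ∈ r.domain} ∧ (P n r).integrand = fun z => r.integrand (fun i : Fin n => z i.succ.succ)) → ∀ c : Literature.NumberTheory.Transcendental.KZ.FormalRep, FreeAbelianGroup.lift (fun s : (Σ n, Literature.NumberTheory.Transcendental.KZ.IntegralRep n) => Literature.NumberTheory.Transcendental.KZ.of (P s.1 s.2)) c ∈ Literature.NumberTheory.Transcendental.KZ.relations → c ∈ Literature.NumberTheory.Transcendental.KZ.relations) →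
    ReducedPeriodRing := by
  intro hnil hpc c hc
  obtain ⟨P, hPin⟩ :=
    Summit.KontsevichZagierPeriods.HurwitzMicroSectors.NormalFormPrincipleSplitGlue.exists_pinnedProduct
  obtain ⟨N, hN⟩ := hnil P hPin c hc
  induction N with
  | zero => simpa using hN
  | succ N ih =>
    exact ih (hpc P hPin _ (by simpa only [Function.iterate_succ_apply'] using hN))

/-! ## Lattice position of child 1 -/

/-- The crux implies child 1 (`N = 0`). [folklore] -/
theorem nilIsPiTorsion_of_reducedPeriodRing (h : ReducedPeriodRing)
    (P : ∀ n : ℕ, IntegralRep n → IntegralRep (n + 2))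
    (_hP : (∀ (n : ℕ) (r : IntegralRep n), (P n r).domain = {z : Fin (n + 2) → ℝ | z 0 ^ 2 + z 1 ^ 2 ≤ 1 ∧ (fun i : Fin n => z i.succ.succ) ∈ r.domain} ∧ (P n r).integrand = fun z => r.integrand (fun i : Fin n => z i.succ.succ)))
    (c : FormalRep) (hc : c * c ∈ relations) :
    ∃ N : ℕ, (⇑(FreeAbelianGroup.lift (fun s : (Σ n, IntegralRep n) => of (P s.1 s.2))))^[N] c ∈ relations :=
  ⟨0, by simpa using h c hc⟩

/-- Item stmt-KontsevichZagierPeriods-0541 (`AyoubPiLocalKernel`, written out) implies child 1: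
a square that is a relation evaluates to `0` (`KZ.eval_mul'`, soundness), so its root lies in
`ker eval`. Child 1 is thus a common weakening of the crux and of 0541. [folklore] -/
theorem nilIsPiTorsion_of_piLocalKernel
    (hloc : ∀ (P : ∀ n : ℕ, IntegralRep n → IntegralRep (n + 2)), (∀ (n : ℕ) (r : IntegralRep n), (P n r).domain = {z : Fin (n + 2) → ℝ | z 0 ^ 2 + z 1 ^ 2 ≤ 1 ∧ (fun i : Fin n => z i.succ.succ) ∈ r.domain} ∧ (P n r).integrand = fun z => r.integrand (fun i : Fin n => z i.succ.succ)) →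
      ∀ c : FormalRep, eval c = 0 →
        ∃ N : ℕ, (⇑(FreeAbelianGroup.lift (fun s : (Σ n, IntegralRep n) => of (P s.1 s.2))))^[N] c ∈ relations)
    (P : ∀ n : ℕ, IntegralRep n → IntegralRep (n + 2))
    (hP : (∀ (n : ℕ) (r : IntegralRep n), (P n r).domain = {z : Fin (n + 2) → ℝ | z 0 ^ 2 + z 1 ^ 2 ≤ 1 ∧ (fun i : Fin n => z i.succ.succ) ∈ r.domain} ∧ (P n r).integrand = fun z => r.integrand (fun i : Fin n => z i.succ.succ)))
    (c : FormalRep) (hc : c * c ∈ relations) :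
    ∃ N : ℕ, (⇑(FreeAbelianGroup.lift (fun s : (Σ n, IntegralRep n) => of (P s.1 s.2))))^[N] c ∈ relations := by
  refine hloc P hP c ?_
  have h0 : eval (c * c) = 0 := relations_le_ker_eval_holds hc
  rw [eval_mul'] at h0
  exact mul_self_eq_zero.mp h0

/-! ## Closed-term form (literal disc `KZ.piRep`) -/

/-- **Closed-term form of the split**: if square-zero classes are `[π]`-power torsion with the literal
disc `KZ.of KZ.piRep * ·` (the shape of `KZ.PiLocalKernel`) and `KZ.PiCancellation`'s body holds, the
crux follows — same peeling. [cite: KontsevichZagier2001, §4.1] -/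
theorem reducedPeriodRing_of_closed
    (hnil : ∀ c : FormalRep, c * c ∈ relations → ∃ N : ℕ, (fun x => of piRep * x)^[N] c ∈ relations)
    (hpc : ∀ c : FormalRep, of piRep * c ∈ relations → c ∈ relations) :
    ReducedPeriodRing := by
  intro c hc
  obtain ⟨N, hN⟩ := hnil c hc
  induction N with
  | zero => simpa using hN
  | succ N ih =>
    exact ih (hpc _ (by simpa only [Function.iterate_succ_apply'] using hN))

/-- Square-zero is stable under `[π] * ·` (relations are a left ideal under the Fubini product and
`*` is commutative/associative modulo relations): if `c * c ∈ relations` then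
`([π] * c) * ([π] * c) ∈ relations`. Used to iterate the closed-term hypotheses. [folklore] -/
theorem piMul_sq_mem_relations {c : FormalRep} (hc : c * c ∈ relations) :
    (of piRep * c) * (of piRep * c) ∈ relations := by
  -- `([π] c)([π] c) ≡ [π] (c ([π] c)) ≡ [π] (([π] c) c) ≡ [π] ([π] (c c))` modulo relations
  have h1 : (of piRep * c) * (of piRep * c) - of piRep * (c * (of piRep * c)) ∈ relations :=
    mul_assoc_sub_mem_relations (of piRep) c (of piRep * c)
  have h2 : c * (of piRep * c) - (of piRep * c) * c ∈ relations := mul_sub_mul_comm_mem_relations _ _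
  have h3 : (of piRep * c) * c - of piRep * (c * c) ∈ relations := mul_assoc_sub_mem_relations (of piRep) c c
  have h4 : of piRep * (c * c) ∈ relations := piRep_mul_mem_relations hc
  have h23 : c * (of piRep * c) - of piRep * (c * c) ∈ relations := by
    have := relations.add_mem h2 h3; simpa using this
  have h5 : c * (of piRep * c) ∈ relations := by
    have := relations.add_mem h23 h4; simpa using this
  have h6 : of piRep * (c * (of piRep * c)) ∈ relations := piRep_mul_mem_relations h5
  have := relations.add_mem h1 h6
  simpa using this

end Summit.KontsevichZagierPeriods.FurushoPentagon.ReducedPeriodRingSplit
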